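import Summits.Ventures.HodgeRepro.TwoPrimeNoSingleClass
import Summits.Ventures.HodgeRepro.TwoPowerTimesTwoInstances

/-!
# The family `(C₂ × C_{2p}, c)`, `p` an odd prime, every involution `c`: EMPTY on the kernel

Blind re-derivation cell `pub-hodge-repro`, seat `p1` (gen 11).  The abstract theorem
`exists_conj_of_sumTwo_kleinPair_twoPrime` (`TwoPrimeNoSingleClass.lean`) instantiated on the typer's
`Multiplicative (ZMod 2 × ZMod (2p))` for its THREE involutions `(0, p)`, `(1, 0)`, `(1, p)`, through the three
surjections onto `ℤ/2p` — `σ(a, x) = x` (kernel `{0, (1, 0)}`), `τ(a, x) = x + p·a` (kernel `{0, (1, p)}`) and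
`ρ(a, x) = 2x + p·a` (kernel `{0, (0, p)}`) — paired as the two kernels avoiding `c`:

* `c = (0, p)`: `φ₀ = σ`, `φ₁ = τ`; `c = (1, 0)`: `φ₀ = ρ`, `φ₁ = τ`; `c = (1, p)`: `φ₀ = ρ`, `φ₁ = σ`.

`not_isSingleClass_C2xC2p_*` restate the three results in the shape of the census rows, and the members
`p = 3, 5, 7, 11, 13` (census EMPTY) and `p = 19, 23, 29` (the cases of job j162904) are one-line corollaries.
-/

set_option autoImplicit false

open Finset Function
open scoped Pointwise

namespace HodgeRepro.TwoPowerTimesTwo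

section FamilyCore

variable (p : ℕ)

/-- `C₂ × C_{2p}` as a multiplicative group. -/
abbrev G2p : Type := Multiplicative (ZMod 2 × ZMod (2 * p))

/-- `p + p = 0` in `ℤ/2p`. -/
theorem p_add_p : ((p : ℕ) : ZMod (2 * p)) + p = 0 := by
  rw [← Nat.cast_add, ← two_mul, ZMod.natCast_self]

/-- Every element of `ℤ/2` is `0` or `1`. -/
theorem zmod2_zero_or_one (a : ZMod 2) : a = 0 ∨ a = 1 := by revert a; decide

/-! ### The three surjections -/

/-- `σ(a, x) = x`. -/
def sigma2p : G2p p →* Multiplicative (ZMod (2 * p)) :=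
  AddMonoidHom.toMultiplicative (AddMonoidHom.snd (ZMod 2) (ZMod (2 * p)))

/-- `τ(a, x) = x + p·a`. -/
def tau2p : G2p p →* Multiplicative (ZMod (2 * p)) :=
  AddMonoidHom.toMultiplicative
    (AddMonoidHom.snd (ZMod 2) (ZMod (2 * p)) + (halfMap p (p_add_p p)).comp (AddMonoidHom.fst (ZMod 2) (ZMod (2 * p))))

/-- `ρ(a, x) = 2x + p·a`. -/
def rho2p : G2p p →* Multiplicative (ZMod (2 * p)) :=
  AddMonoidHom.toMultiplicative
    ((AddMonoidHom.snd (ZMod 2) (ZMod (2 * p)) + AddMonoidHom.snd (ZMod 2) (ZMod (2 * p))) +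
      (halfMap p (p_add_p p)).comp (AddMonoidHom.fst (ZMod 2) (ZMod (2 * p))))

/-- `σ (a, x) = x`. -/
theorem sigma2p_apply (a : ZMod 2) (x : ZMod (2 * p)) : sigma2p p (Multiplicative.ofAdd (a, x)) = Multiplicative.ofAdd x := rfl

/-- `τ (a, x) = x + (if a = 0 then 0 else p)`. -/
theorem tau2p_apply (a : ZMod 2) (x : ZMod (2 * p)) :
    tau2p p (Multiplicative.ofAdd (a, x)) = Multiplicative.ofAdd (x + if a = 0 then 0 else (p : ZMod (2 * p))) := rfl

/-- `ρ (a, x) = x + x + (if a = 0 then 0 else p)`. -/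
theorem rho2p_apply (a : ZMod 2) (x : ZMod (2 * p)) :
    rho2p p (Multiplicative.ofAdd (a, x)) =
      Multiplicative.ofAdd (x + x + if a = 0 then 0 else (p : ZMod (2 * p))) := rfl

/-- `σ` is surjective. -/
theorem sigma2p_surjective : Surjective (sigma2p p) := fun y =>
  ⟨Multiplicative.ofAdd (0, Multiplicative.toAdd y), by rw [sigma2p_apply, ofAdd_toAdd]⟩

/-- `τ` is surjective. -/
theorem tau2p_surjective : Surjective (tau2p p) := fun y =>
  ⟨Multiplicative.ofAdd (0, Multiplicative.toAdd y), by rw [tau2p_apply, if_pos rfl, add_zero, ofAdd_toAdd]⟩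

/-- The kernel of `σ` is `{0, (1, 0)}`. -/
theorem sigma2p_ker (z : G2p p) : sigma2p p z = 1 ↔ z = 1 ∨ z = Multiplicative.ofAdd ((1 : ZMod 2), (0 : ZMod (2 * p))) := by
  obtain ⟨⟨a, x⟩, rfl⟩ := Multiplicative.ofAdd.surjective z
  rw [sigma2p_apply, ofAdd_eq_one, ofAdd_eq_one, Multiplicative.ofAdd.injective.eq_iff, Prod.mk_eq_zero,
    Prod.mk.injEq]
  constructor
  · intro hx
    rcases zmod2_zero_or_one a with rfl | rfl
    · exact Or.inl ⟨rfl, hx⟩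
    · exact Or.inr ⟨rfl, hx⟩
  · rintro (⟨_, hx⟩ | ⟨_, hx⟩) <;> exact hx

/-- The kernel of `τ` is `{0, (1, p)}`. -/
theorem tau2p_ker (z : G2p p) :
    tau2p p z = 1 ↔ z = 1 ∨ z = Multiplicative.ofAdd ((1 : ZMod 2), (p : ZMod (2 * p))) := by
  obtain ⟨⟨a, x⟩, rfl⟩ := Multiplicative.ofAdd.surjective z
  rw [tau2p_apply, ofAdd_eq_one, ofAdd_eq_one, Multiplicative.ofAdd.injective.eq_iff, Prod.mk_eq_zero,
    Prod.mk.injEq]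
  have h10 : ¬ ((1 : ZMod 2) = 0) := by decide
  rcases zmod2_zero_or_one a with rfl | rfl
  · rw [if_pos rfl, add_zero]
    constructor
    · intro hx; exact Or.inl ⟨rfl, hx⟩
    · rintro (⟨_, hx⟩ | ⟨h, _⟩)
      · exact hx
      · exact absurd h.symm h10
  · rw [if_neg h10]
    have hneg : -((p : ℕ) : ZMod (2 * p)) = ((p : ℕ) : ZMod (2 * p)) := neg_eq_of_add_eq_zero_right (p_add_p p)
    constructor
    · intro hx
      refine Or.inr ⟨rfl, ?_⟩
      rw [← hneg]; exact eq_neg_of_add_eq_zero_left hx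
    · rintro (⟨h, _⟩ | ⟨_, hx⟩)
      · exact absurd h h10
      · rw [hx, p_add_p]

/-- `(1, 0) ≠ 1`. -/
theorem ofAdd_one_zero_ne_one : Multiplicative.ofAdd ((1 : ZMod 2), (0 : ZMod (2 * p))) ≠ 1 := by
  rw [Ne, ofAdd_eq_one, Prod.mk_eq_zero]; exact fun h => absurd h.1 (by decide)

/-- `(1, p) ≠ 1`. -/
theorem ofAdd_one_p_ne_one : Multiplicative.ofAdd ((1 : ZMod 2), (p : ZMod (2 * p))) ≠ 1 := by
  rw [Ne, ofAdd_eq_one, Prod.mk_eq_zero]; exact fun h => absurd h.1 (by decide)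

/-- Every involution-candidate `(a, b)` with `b ∈ {0, p}` is a complex conjugation when non-trivial. -/
theorem isComplexConj_of_ne_one {w : G2p p} (hw : w ≠ 1) (hsq : w * w = 1) : IsComplexConj w :=
  ⟨hw, hsq, fun g => mul_comm _ g⟩

end FamilyCore

section Family

variable (p : ℕ) [NeZero p]

/-- `2p ≠ 0`. -/
instance instNeZeroTwoMulP : NeZero (2 * p) := ⟨by have := NeZero.ne p; omega⟩

/-- `x + x = 0` in `ℤ/2p` exactly for `x ∈ {0, p}`. -/
theorem add_self_eq_zero_iff (x : ZMod (2 * p)) : x + x = 0 ↔ x = 0 ∨ x = (p : ZMod (2 * p)) := by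
  constructor
  · intro h
    have h1 : ((x.val + x.val : ℕ) : ZMod (2 * p)) = 0 := by
      rw [Nat.cast_add, ZMod.natCast_zmod_val]; exact h
    rw [ZMod.natCast_eq_zero_iff, ← two_mul] at h1
    have h2 : p ∣ x.val := (Nat.mul_dvd_mul_iff_left (by norm_num : 0 < 2)).mp h1
    obtain ⟨m, hm⟩ := h2
    have hlt : x.val < 2 * p := ZMod.val_lt x
    rw [hm, mul_comm 2 p] at hlt
    have hm2 : m < 2 := Nat.lt_of_mul_lt_mul_left hlt
    interval_cases m
    · exact Or.inl ((ZMod.val_eq_zero x).mp (by rw [hm]; ring))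
    · right; rw [← ZMod.natCast_zmod_val x, hm, mul_one]
  · rintro (rfl | rfl)
    · rw [add_zero]
    · exact p_add_p p

/-- `x + x ≠ p` in `ℤ/2p` for `p` odd. -/
theorem add_self_ne_p (hodd : Odd p) (x : ZMod (2 * p)) : x + x ≠ (p : ZMod (2 * p)) := by
  intro h
  have hp1 : p % 2 = 1 := Nat.odd_iff.mp hodd
  have h1 : (x + x).val = p := by
    rw [h, ZMod.val_natCast]
    exact Nat.mod_eq_of_lt (by have := NeZero.ne p; omega)
  rw [ZMod.val_add] at h1
  have h2 : (x.val + x.val) % (2 * p) % 2 = 0 := by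
    rw [Nat.mod_mod_of_dvd _ (Dvd.intro p rfl)]; omega
  rw [h1] at h2
  omega

/-- `ρ` is surjective (`p` odd). -/
theorem rho2p_surjective (hodd : Odd p) : Surjective (rho2p p) := by
  intro y
  have hp1 : p % 2 = 1 := Nat.odd_iff.mp hodd
  obtain ⟨v, hv⟩ : ∃ v : ℕ, y = Multiplicative.ofAdd (v : ZMod (2 * p)) :=
    ⟨(Multiplicative.toAdd y).val, by rw [ZMod.natCast_zmod_val, ofAdd_toAdd]⟩
  rcases Nat.even_or_odd v with ⟨m, hm⟩ | ⟨m, hm⟩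
  · refine ⟨Multiplicative.ofAdd ((0 : ZMod 2), (m : ZMod (2 * p))), ?_⟩
    rw [rho2p_apply, if_pos rfl, add_zero, hv, hm, Nat.cast_add]
  · refine ⟨Multiplicative.ofAdd ((1 : ZMod 2), ((m + (p + 1) / 2 : ℕ) : ZMod (2 * p))), ?_⟩
    rw [rho2p_apply, if_neg one_ne_zero, hv, hm]
    congr 1
    rw [← Nat.cast_add, ← Nat.cast_add, show m + (p + 1) / 2 + (m + (p + 1) / 2) + p = 2 * m + 1 + 2 * p by omega,
      Nat.cast_add (2 * m + 1), ZMod.natCast_self, add_zero]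

/-- The kernel of `ρ` is `{0, (0, p)}` (`p` odd). -/
theorem rho2p_ker (hodd : Odd p) (z : G2p p) :
    rho2p p z = 1 ↔ z = 1 ∨ z = Multiplicative.ofAdd ((0 : ZMod 2), (p : ZMod (2 * p))) := by
  obtain ⟨⟨a, x⟩, rfl⟩ := Multiplicative.ofAdd.surjective z
  rw [rho2p_apply, ofAdd_eq_one, ofAdd_eq_one, Multiplicative.ofAdd.injective.eq_iff, Prod.mk_eq_zero,
    Prod.mk.injEq]
  have h10 : ¬ ((1 : ZMod 2) = 0) := by decide
  rcases zmod2_zero_or_one a with rfl | rfl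
  · rw [if_pos rfl, add_zero, add_self_eq_zero_iff]
    constructor
    · rintro (hx | hx)
      · exact Or.inl ⟨rfl, hx⟩
      · exact Or.inr ⟨rfl, hx⟩
    · rintro (⟨_, hx⟩ | ⟨_, hx⟩)
      · exact Or.inl hx
      · exact Or.inr hx
  · rw [if_neg h10]
    constructor
    · intro hx
      exfalso
      have hneg : -((p : ℕ) : ZMod (2 * p)) = ((p : ℕ) : ZMod (2 * p)) :=
        neg_eq_of_add_eq_zero_right (p_add_p p)
      have h1 : x + x = (p : ZMod (2 * p)) := by rw [← hneg]; exact eq_neg_of_add_eq_zero_left hx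
      exact add_self_ne_p p hodd x h1
    · rintro (⟨h, _⟩ | ⟨h, _⟩) <;> exact absurd h h10

/-- `(0, p) ≠ 1`. -/
theorem ofAdd_zero_p_ne_one : Multiplicative.ofAdd ((0 : ZMod 2), (p : ZMod (2 * p))) ≠ 1 := by
  rw [Ne, ofAdd_eq_one, Prod.mk_eq_zero]
  exact fun h => CyclicQuad.natCast_half_ne_zero (m := p) rfl h.2

/-! ### The three involutions -/

/-- **`(C₂ × C_{2p}, (0, p))`**: every `SumTwo` quadruple of twists of a CM type has a conjugate pair. -/
theorem exists_conj_of_sumTwo_C2xC2p_sq (hp : p.Prime) (hp2 : p ≠ 2) (Φ : Finset (G2p p))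
    (hΦ : IsCMType (Multiplicative.ofAdd ((0 : ZMod 2), (p : ZMod (2 * p)))) Φ) (g : Fin 4 → G2p p)
    (hs : SumTwo (fun i => rmul Φ (g i))) :
    ∃ i j : Fin 4, rmul Φ (g j) = Multiplicative.ofAdd ((0 : ZMod 2), (p : ZMod (2 * p))) • rmul Φ (g i) := by
  have hc : IsComplexConj (Multiplicative.ofAdd ((0 : ZMod 2), (p : ZMod (2 * p)))) :=
    isComplexConj_of_ne_one p (ofAdd_zero_p_ne_one p) (by rw [← ofAdd_add, Prod.mk_add_mk, p_add_p, add_zero]; rfl)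
  exact exists_conj_of_sumTwo_kleinPair_twoPrime hp hp2 rfl hc (sigma2p p) (tau2p p) (sigma2p_surjective p) (tau2p_surjective p)
    (by rw [sigma2p_apply]) (by rw [tau2p_apply, if_pos rfl, add_zero]) (sigma2p_ker p) (tau2p_ker p)
    (ofAdd_one_zero_ne_one p) (ofAdd_one_p_ne_one p)
    (by rw [← ofAdd_add, Prod.mk_add_mk, add_zero, zero_add]) Φ hΦ g hs

/-- **`(C₂ × C_{2p}, (1, 0))`**: every `SumTwo` quadruple of twists of a CM type has a conjugate pair. -/
theorem exists_conj_of_sumTwo_C2xC2p_ns (hp : p.Prime) (hp2 : p ≠ 2) (Φ : Finset (G2p p))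
    (hΦ : IsCMType (Multiplicative.ofAdd ((1 : ZMod 2), (0 : ZMod (2 * p)))) Φ) (g : Fin 4 → G2p p)
    (hs : SumTwo (fun i => rmul Φ (g i))) :
    ∃ i j : Fin 4, rmul Φ (g j) = Multiplicative.ofAdd ((1 : ZMod 2), (0 : ZMod (2 * p))) • rmul Φ (g i) := by
  have hodd : Odd p := hp.odd_of_ne_two hp2
  have hc : IsComplexConj (Multiplicative.ofAdd ((1 : ZMod 2), (0 : ZMod (2 * p)))) :=
    isComplexConj_of_ne_one p (ofAdd_one_zero_ne_one p)
      (by rw [← ofAdd_add, Prod.mk_add_mk, add_zero, show (1 : ZMod 2) + 1 = 0 by decide]; rfl)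
  exact exists_conj_of_sumTwo_kleinPair_twoPrime hp hp2 rfl hc (rho2p p) (tau2p p) (rho2p_surjective p hodd)
    (tau2p_surjective p) (by rw [rho2p_apply, if_neg (by decide), add_zero, zero_add])
    (by rw [tau2p_apply, if_neg (by decide), zero_add]) (rho2p_ker p hodd) (tau2p_ker p)
    (ofAdd_zero_p_ne_one p) (ofAdd_one_p_ne_one p)
    (by rw [← ofAdd_add, Prod.mk_add_mk, zero_add, add_zero]) Φ hΦ g hs

/-- **`(C₂ × C_{2p}, (1, p))`**: every `SumTwo` quadruple of twists of a CM type has a conjugate pair. -/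
theorem exists_conj_of_sumTwo_C2xC2p_ns' (hp : p.Prime) (hp2 : p ≠ 2) (Φ : Finset (G2p p))
    (hΦ : IsCMType (Multiplicative.ofAdd ((1 : ZMod 2), (p : ZMod (2 * p)))) Φ) (g : Fin 4 → G2p p)
    (hs : SumTwo (fun i => rmul Φ (g i))) :
    ∃ i j : Fin 4, rmul Φ (g j) = Multiplicative.ofAdd ((1 : ZMod 2), (p : ZMod (2 * p))) • rmul Φ (g i) := by
  have hodd : Odd p := hp.odd_of_ne_two hp2
  have hc : IsComplexConj (Multiplicative.ofAdd ((1 : ZMod 2), (p : ZMod (2 * p)))) :=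
    isComplexConj_of_ne_one p (ofAdd_one_p_ne_one p)
      (by rw [← ofAdd_add, Prod.mk_add_mk, p_add_p, show (1 : ZMod 2) + 1 = 0 by decide]; rfl)
  exact exists_conj_of_sumTwo_kleinPair_twoPrime hp hp2 rfl hc (rho2p p) (sigma2p p) (rho2p_surjective p hodd)
    (sigma2p_surjective p) (by rw [rho2p_apply, if_neg (by decide), p_add_p, zero_add]) (by rw [sigma2p_apply])
    (rho2p_ker p hodd) (sigma2p_ker p) (ofAdd_zero_p_ne_one p) (ofAdd_one_zero_ne_one p)
    (by rw [← ofAdd_add, Prod.mk_add_mk, zero_add, p_add_p]) Φ hΦ g hs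

/-- The census-row shape for all three involutions: no single-class `SumTwo` quadruple of CM types of
`(C₂ × C_{2p}, c)` without a conjugate pair, `p` an odd prime. -/
theorem not_isSingleClass_C2xC2p (hp : p.Prime) (hp2 : p ≠ 2) (c : G2p p)
    (hc : c = Multiplicative.ofAdd ((0 : ZMod 2), (p : ZMod (2 * p))) ∨
      c = Multiplicative.ofAdd ((1 : ZMod 2), (0 : ZMod (2 * p))) ∨
      c = Multiplicative.ofAdd ((1 : ZMod 2), (p : ZMod (2 * p))))
    (T : Fin 4 → Finset (G2p p)) (hT : IsCMType c (T 0)) (hs : SumTwo T)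
    (hnc : ∀ i j : Fin 4, T j ≠ c • T i) : ¬ IsSingleClass T := by
  intro hsc
  choose g hg using hsc
  have hT' : T = fun i => rmul (T 0) (g i) := funext hg
  have hs' : SumTwo (fun i => rmul (T 0) (g i)) := by rw [← hT']; exact hs
  rcases hc with rfl | rfl | rfl
  · obtain ⟨i, j, hij⟩ := exists_conj_of_sumTwo_C2xC2p_sq p hp hp2 (T 0) hT g hs'
    exact hnc i j (by rw [hg j, hg i]; exact hij)
  · obtain ⟨i, j, hij⟩ := exists_conj_of_sumTwo_C2xC2p_ns p hp hp2 (T 0) hT g hs'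
    exact hnc i j (by rw [hg j, hg i]; exact hij)
  · obtain ⟨i, j, hij⟩ := exists_conj_of_sumTwo_C2xC2p_ns' p hp hp2 (T 0) hT g hs'
    exact hnc i j (by rw [hg j, hg i]; exact hij)

/-! ### Members: the census rows `p = 5, 7, 11, 13` and the job-j162904 cases `p = 19, 23, 29` -/

/-- `(C₂ × C₁₀, c)` for every involution `c` (census EMPTY, orders 8–28). -/
theorem not_isSingleClass_C2xC10 (c : G2p 5)
    (hc : c = Multiplicative.ofAdd ((0 : ZMod 2), (5 : ZMod (2 * 5))) ∨
      c = Multiplicative.ofAdd ((1 : ZMod 2), (0 : ZMod (2 * 5))) ∨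
      c = Multiplicative.ofAdd ((1 : ZMod 2), (5 : ZMod (2 * 5))))
    (T : Fin 4 → Finset (G2p 5)) (hT : IsCMType c (T 0)) (hs : SumTwo T)
    (hnc : ∀ i j : Fin 4, T j ≠ c • T i) : ¬ IsSingleClass T :=
  not_isSingleClass_C2xC2p 5 (by norm_num) (by norm_num) c hc T hT hs hnc

/-- `(C₂ × C₂₆, c)` for every involution `c` (census EMPTY, job j160088: `C₂ × C₂₆` at all three `c`). -/
theorem not_isSingleClass_C2xC26 (c : G2p 13)
    (hc : c = Multiplicative.ofAdd ((0 : ZMod 2), (13 : ZMod (2 * 13))) ∨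
      c = Multiplicative.ofAdd ((1 : ZMod 2), (0 : ZMod (2 * 13))) ∨
      c = Multiplicative.ofAdd ((1 : ZMod 2), (13 : ZMod (2 * 13))))
    (T : Fin 4 → Finset (G2p 13)) (hT : IsCMType c (T 0)) (hs : SumTwo T)
    (hnc : ∀ i j : Fin 4, T j ≠ c • T i) : ¬ IsSingleClass T :=
  not_isSingleClass_C2xC2p 13 (by norm_num) (by norm_num) c hc T hT hs hnc

/-- `(C₂ × C₅₈, c)` for every involution `c` — order `116`, beyond every census (job j162904's largest case). -/
theorem not_isSingleClass_C2xC58 (c : G2p 29)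
    (hc : c = Multiplicative.ofAdd ((0 : ZMod 2), (29 : ZMod (2 * 29))) ∨
      c = Multiplicative.ofAdd ((1 : ZMod 2), (0 : ZMod (2 * 29))) ∨
      c = Multiplicative.ofAdd ((1 : ZMod 2), (29 : ZMod (2 * 29))))
    (T : Fin 4 → Finset (G2p 29)) (hT : IsCMType c (T 0)) (hs : SumTwo T)
    (hnc : ∀ i j : Fin 4, T j ≠ c • T i) : ¬ IsSingleClass T :=
  not_isSingleClass_C2xC2p 29 (by norm_num) (by norm_num) c hc T hT hs hnc

end Family

end HodgeRepro.TwoPowerTimesTwo
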